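import Summits.KontsevichZagierPeriods.KontsevichZagierPeriods.Theorems.UnfoldedStokesStokesGenerationStubRungValue
import Summits.KontsevichZagierPeriods.KontsevichZagierPeriods.Theorems.UnfoldedStokesStokesGenerationStubRungCertificate
import Summits.KontsevichZagierPeriods.KontsevichZagierPeriods.Theorems.UnfoldedStokesStokesGenerationStubRungLogDerivProd
import Summits.KontsevichZagierPeriods.KontsevichZagierPeriods.Theorems.InverseLandauTateLiftingBakerDecomposition

/-!
# `StokesGeneration` (stmt-KontsevichZagierPeriods-3586), line `fibrewise_stokes` — the residual S2 on its Baker sector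

Crux `Summit.KontsevichZagierPeriods.KontsevichZagierPeriods.Theses.UnfoldedStokes.StokesGeneration` (kernel-checked
equivalent to the summit). Line `fibrewise_stokes` reduces it to the residual S2 = `FibrewiseStokesGenerationConjecture`
(`Theorems/FibrewiseStokesGenerationConjecture.lean`): every bounded closed-cube representation of value `0` is, after
padding and off a null `ℚ`-semialgebraic set, a finite sum of FIBREWISE STOKES ELEMENTS `D − (G|_{xᵢ=1} − G|_{xᵢ=0})`.

This file proves S2 — with exactly its conclusion, `M' = 2`, no kink sets, no null set — on the first sector in which
it has transcendental content: one-variable integrands with simple REAL algebraic poles,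
`h(z) = Σᵢ cᵢ/(z − aᵢ)` on `[0,1]`, `aᵢ, cᵢ` real algebraic, `aᵢ ∉ [0,1]`. Unconditionally:

1. the value is `Σᵢ cᵢ log(1 − 1/aᵢ)` (`stub_rungValue`, p124409);
2. if it vanishes, BAKER'S THEOREM — proved in the tree, `Literature.NumberTheory.Transcendental.baker_holds`; used in
   its decomposition form `Summit.KontsevichZagierPeriods.InverseLandau.tateLifting_bakerDecomposition` — writes
   `c = Σ_q γ_q M_q` with `γ_q` real algebraic and `M_q ∈ ℤ^s` integer multiplicative relations `Πᵢ (1 − 1/aᵢ)^{M_q i} = 1`;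
3. for each relation `M`, `Σᵢ Mᵢ/(z − aᵢ) = P'/P` with `P(z) = Πᵢ (1 − z/aᵢ)^{Mᵢ} > 0` on `[0,1]`, `P(0) = P(1) = 1`
   (`stub_rungLogDerivProd`, p124502), and `γ · P'/P` is the sum of TWO fibrewise Stokes elements on `[0,1]²` with
   rational primitives `G₀ = γ (P − 1)/(1 + (P − 1)x₁)` (direction `0`) and `G₁ = γ x₁ P' (1/P − 1/(1 + (P − 1)x₁))`
   (direction `1`) — a divergence-form certificate, `∂₀G₀ + ∂₁G₁ = γ P'/P`, all four boundary terms vanishing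
   (`stub_rungCertificate`, p124720);
4. concatenating the `2·t` elements and substituting Baker's decomposition gives the conclusion of S2 for `h`.

So on the Baker sector the residual holds in the line's strict generator economy: the functional equation of the logarithm
needs no change of variables and no domain additivity, only fibrewise Newton–Leibniz elements in one extra variable
(cf. Kontsevich–Zagier's accessible identity `log 6 = log 2 + log 3`, proved there with a substitution).

References: A. Baker, *Transcendental Number Theory* (1975), Thm. 2.1; M. Kontsevich, D. Zagier, *Periods* (2001), §1.1–1.2;
J. Ayoub, Ann. of Math. 181 (2015), Conj. 1.1, Rem. 1.5; J. Fresán, *Une introduction aux périodes* (2024), Rem. 3.7.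
-/

noncomputable section

set_option linter.dupNamespace false

namespace Summit.KontsevichZagierPeriods.KontsevichZagierPeriods.Cruxes.StokesGeneration.FibrewiseStokes

open MeasureTheory Set
open Literature.NumberTheory.Transcendental
open Literature.NumberTheory.Transcendental.KZ
open Literature.ModelTheory.ExponentialFields (IsSemialgebraic)

/-- **S2 on the Baker sector (rung, assembled; lead c2).** A closed-interval representation with
integrand `Σᵢ cᵢ/(z − aᵢ)` (`aᵢ, cᵢ` real algebraic, `aᵢ ∉ [0,1]`) and value `0` satisfies the
conclusion of `FibrewiseStokesGeneration` with `M' = 2`: Baker's theorem (proved in the tree) reduces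
the vanishing of `Σᵢ cᵢ log(1 − 1/aᵢ)` to integer multiplicative relations, each certified by two
fibrewise Stokes elements (`stub_rungCertificate` ∘ `stub_rungLogDerivProd`).
[cite: Baker1975, Thm 2.1] -/
theorem fibrewiseStokesGeneration_simpleRealPoles :
    ∀ (s : ℕ) (a c : Fin s → ℝ), (∀ i, IsAlgebraic ℚ (a i)) → (∀ i, IsAlgebraic ℚ (c i)) →
      (∀ i, a i < 0 ∨ 1 < a i) → ∀ (t : IntegralRep 1),
      t.domain = Set.pi Set.univ (fun _ : Fin 1 => Set.Icc (0:ℝ) 1) →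
      (∀ z ∈ Set.pi Set.univ (fun _ : Fin 1 => Set.Icc (0:ℝ) 1), t.integrand z = ∑ i, c i / (z 0 - a i)) →
      t.value = 0 →
    ∃ (M' : ℕ) (hMM' : 1 ≤ M') (J : ℕ) (i : Fin J → Fin M') (G D : Fin J → (Fin M' → ℝ) → ℝ)
      (K : Fin J → Set (Fin M' → ℝ)) (q : Fin J → IntegralRep M') (Z : Set (Fin M' → ℝ)),
      (∀ j, IsSemialgebraicFunOn ℚ (Set.pi Set.univ (fun _ : Fin M' => Set.Icc (0:ℝ) 1)) (G j) ∧
        IsSemialgebraicFunOn ℚ (Set.pi Set.univ (fun _ : Fin M' => Set.Icc (0:ℝ) 1)) (D j) ∧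
        IsSemialgebraic ℚ (K j) ∧
        (∃ B : ℝ, ∀ x ∈ Set.pi Set.univ (fun _ : Fin M' => Set.Icc (0:ℝ) 1), |(G j) x| ≤ B) ∧
        (∀ x ∈ Set.pi Set.univ (fun _ : Fin M' => Set.Icc (0:ℝ) 1), Set.Finite {s : ℝ | Function.update x (i j) s ∈ (K j)}) ∧
        (∀ x ∈ Set.pi Set.univ (fun _ : Fin M' => Set.Icc (0:ℝ) 1), ContinuousOn (fun s : ℝ => (G j) (Function.update x (i j) s)) (Set.Icc (0:ℝ) 1)) ∧
        (∀ x ∈ Set.pi Set.univ (fun _ : Fin M' => Set.Icc (0:ℝ) 1), x ∉ (K j) → x (i j) ∈ Set.Ioo (0:ℝ) 1 →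
          HasDerivAt (fun s : ℝ => (G j) (Function.update x (i j) s)) ((D j) x) (x (i j)))) ∧
      (∀ j, (q j).domain = Set.pi Set.univ (fun _ : Fin M' => Set.Icc (0:ℝ) 1) ∧
        ∀ x ∈ Set.pi Set.univ (fun _ : Fin M' => Set.Icc (0:ℝ) 1), (q j).integrand x =
          D j x - (G j (Function.update x (i j) 1) - G j (Function.update x (i j) 0))) ∧
      IsSemialgebraic ℚ Z ∧ volume Z = 0 ∧
      ∀ x ∈ Set.pi Set.univ (fun _ : Fin M' => Set.Icc (0:ℝ) 1), x ∉ Z →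
        t.integrand (fun l => x (Fin.castLE hMM' l)) = ∑ j, (q j).integrand x := by
  intro s a c ha hc ha01 t ht hti hval
  classical
  -- the value is `Σ cᵢ log(1 − 1/aᵢ)`, and it vanishes
  have hsum : ∑ i, c i * Real.log (1 - (a i)⁻¹) = 0 := by
    rw [← stub_rungValue s a c ha01 t ht hti]; exact hval
  have hαpos : ∀ i, 0 < 1 - (a i)⁻¹ := by
    intro i
    rcases ha01 i with h | h
    · have : (a i)⁻¹ < 0 := inv_lt_zero.mpr h
      linarith
    · have : (a i)⁻¹ < 1 := inv_lt_one_of_one_lt₀ h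
      linarith
  have hαalg : ∀ i, IsAlgebraic ℚ (1 - (a i)⁻¹) := fun i =>
    mem_algebraicClosure_iff.mp (sub_mem (one_mem _) (inv_mem (mem_algebraicClosure_iff.mpr (ha i))))
  -- Baker: `c = Σ_q γ_q M_q` with integer multiplicative relations `M_q`
  obtain ⟨tq, Mq, γ, hγ, hMq, hcM⟩ :=
    Summit.KontsevichZagierPeriods.InverseLandau.tateLifting_bakerDecomposition s
      (fun i => 1 - (a i)⁻¹) c hαpos hαalg hc hsum
  -- the normalised products and their logarithmic derivatives
  set P : Fin tq → ℝ → ℝ := fun q u => ∏ i, (1 - u / a i) ^ (Mq q i) with hP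
  set P' : Fin tq → ℝ → ℝ := fun q u => P q u * ∑ i, (Mq q i : ℝ) / (u - a i) with hP'
  have hR3 := fun q => stub_rungLogDerivProd s a (Mq q) (P q) (P' q) ha ha01 (hMq q)
    (fun u => rfl) (fun u => rfl)
  -- two fibrewise Stokes elements per relation
  have hR2 : ∀ q, ∃ (G D : Fin 2 → (Fin 2 → ℝ) → ℝ) (r : Fin 2 → IntegralRep 2),
      (∀ j, IsSemialgebraicFunOn ℚ (Set.pi Set.univ (fun _ : Fin 2 => Set.Icc (0:ℝ) 1)) (G j) ∧
        IsSemialgebraicFunOn ℚ (Set.pi Set.univ (fun _ : Fin 2 => Set.Icc (0:ℝ) 1)) (D j) ∧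
        (∃ B : ℝ, ∀ x ∈ Set.pi Set.univ (fun _ : Fin 2 => Set.Icc (0:ℝ) 1), |(G j) x| ≤ B) ∧
        (∀ x ∈ Set.pi Set.univ (fun _ : Fin 2 => Set.Icc (0:ℝ) 1),
          ContinuousOn (fun s : ℝ => (G j) (Function.update x j s)) (Set.Icc (0:ℝ) 1)) ∧
        (∀ x ∈ Set.pi Set.univ (fun _ : Fin 2 => Set.Icc (0:ℝ) 1), x j ∈ Set.Ioo (0:ℝ) 1 →
          HasDerivAt (fun s : ℝ => (G j) (Function.update x j s)) ((D j) x) (x j))) ∧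
      (∀ j, (r j).domain = Set.pi Set.univ (fun _ : Fin 2 => Set.Icc (0:ℝ) 1) ∧
        ∀ x ∈ Set.pi Set.univ (fun _ : Fin 2 => Set.Icc (0:ℝ) 1), (r j).integrand x =
          D j x - (G j (Function.update x j 1) - G j (Function.update x j 0))) ∧
      ∀ x ∈ Set.pi Set.univ (fun _ : Fin 2 => Set.Icc (0:ℝ) 1),
        γ q * (P' q (x 0) / P q (x 0)) = ∑ j, (r j).integrand x := fun q =>
    stub_rungCertificate (γ q) (P q) (P' q) (hγ q) (hR3 q).1 (hR3 q).2.1 (hR3 q).2.2.1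
      (hR3 q).2.2.2.1 (hR3 q).2.2.2.2.1 (hR3 q).2.2.2.2.2.1 (hR3 q).2.2.2.2.2.2.1
      (hR3 q).2.2.2.2.2.2.2.1
  choose G D r hGD hr hid using hR2
  -- concatenate the `2 · tq` elements
  set e : Fin tq × Fin 2 ≃ Fin (tq * 2) := finProdFinEquiv with he
  refine ⟨2, by norm_num, tq * 2, fun j => (e.symm j).2, fun j => G (e.symm j).1 (e.symm j).2,
    fun j => D (e.symm j).1 (e.symm j).2, fun _ => ∅, fun j => r (e.symm j).1 (e.symm j).2, ∅,
    fun j => ?_, fun j => hr (e.symm j).1 (e.symm j).2,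
    Literature.ModelTheory.ExponentialFields.isSemialgebraic_empty, measure_empty, ?_⟩
  · obtain ⟨h1, h2, h3, h4, h5⟩ := hGD (e.symm j).1 (e.symm j).2
    exact ⟨h1, h2, Literature.ModelTheory.ExponentialFields.isSemialgebraic_empty, h3,
      fun x _ => by simp, h4, fun x hx _ hxj => h5 x hx hxj⟩
  · intro x hx _
    have hx0 : x 0 ∈ Set.Icc (0:ℝ) 1 := hx 0 (Set.mem_univ _)
    have hx1 : (fun l : Fin 1 => x (Fin.castLE (by norm_num : 1 ≤ 2) l)) ∈
        Set.pi Set.univ (fun _ : Fin 1 => Set.Icc (0:ℝ) 1) := fun l _ => hx _ (Set.mem_univ _)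
    rw [hti _ hx1]
    have hcast : x (Fin.castLE (by norm_num : 1 ≤ 2) 0) = x 0 := rfl
    simp only [hcast]
    -- right-hand side: regroup the concatenated sum
    have hrhs : ∑ j : Fin (tq * 2), (r (e.symm j).1 (e.symm j).2).integrand x =
        ∑ q, γ q * ∑ i, (Mq q i : ℝ) / (x 0 - a i) := by
      rw [e.symm.sum_comp (fun p : Fin tq × Fin 2 => (r p.1 p.2).integrand x),
        Fintype.sum_prod_type]
      refine Finset.sum_congr rfl fun q _ => ?_
      rw [← hid q x hx, (hR3 q).2.2.2.2.2.2.2.2 (x 0) hx0]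
    rw [hrhs]
    -- left-hand side: substitute Baker's decomposition of `c`
    calc ∑ i, c i / (x 0 - a i) = ∑ i, (∑ q, γ q * (Mq q i : ℝ)) / (x 0 - a i) := by
          simp only [← hcM]
      _ = ∑ i, ∑ q, γ q * ((Mq q i : ℝ) / (x 0 - a i)) := by
          simp only [Finset.sum_div, mul_div_assoc]
      _ = ∑ q, γ q * ∑ i, (Mq q i : ℝ) / (x 0 - a i) := by
          rw [Finset.sum_comm]; simp only [Finset.mul_sum]

end Summit.KontsevichZagierPeriods.KontsevichZagierPeriods.Cruxes.StokesGeneration.FibrewiseStokes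

end
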